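import Summits.QuantumAdvantage.QuantumAdvantage.Theorems.WhiteBoxWalkWbwObfuscatedGluedTreesRealIdeal
import Literature.Computability.Cryptography.IndistinguishabilityObfuscatorSubexp

/-!
# Line `knowledge-of-walk-split`, STAGE 6 — numeric and asymptotic forms of `IdealCodeSoundness`
# (crux `WbwObfuscatedGluedTrees`, stmt-QuantumAdvantage-2340, route WhiteBoxWalk; lead prover-line-stmt-QuantumAdvantage-2340-c5-0)

Companion of the stage-6 closing file `Theorems/WhiteBoxWalkWbwObfuscatedGluedTreesRealIdeal.lean`
(`idealCodeSoundness_holds`): (§3) the Luby–Rackoff slack of the stage-6 bound is `≤ 12 t²/2^{⌊d/2⌋} ≤ 17·2^{-d/6}` at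
`t ≤ 2^{d/6}`, whence the headline bound `codeSuccessProb ≤ 38·2^{-d/6} + 2^{2d+4}/2^μ` in the admissible region and its
instance at the generator's own schedules; (§4) the clause-(C)-shaped asymptotic form: at schedules with depth eventually
above `n^ε`, eventually no truncation, and a negligible tag gap, every polynomial round budget is admissible and ONE
negligible function bounds the ideal-model-II success probability of every black-box walker.
-/

set_option linter.dupNamespace false

noncomputable section

namespace Summit.QuantumAdvantage.QuantumAdvantage.Cruxes.WbwObfuscatedGluedTrees.KnowledgeOfWalkSplit.RealIdeal

open Literature.Computability.Complexity Literature.Computability.QuantumComplexity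
open Literature.Computability.QuantumComplexity.GluedTrees
open Literature.Computability.Cryptography Literature.Computability.Cryptography.ObfuscatedGluedTrees
open Summit.QuantumAdvantage.QuantumAdvantage.Theorems.WbwObfuscatedGluedTrees.KnowledgeOfWalk.BlackBox
open Summit.QuantumAdvantage.QuantumAdvantage.Theorems.WbwObfuscatedGluedTrees.KnowledgeOfWalk.RealIdeal

/-! ## §3 Numeric form of conjunct (i): the admissible parameter region of ideal model II -/

/-- The Luby–Rackoff slack of the stage-6 bound: `lrSlack ⌊d/2⌋ ⌈d/2⌉ (2t) ≤ 12 t² / 2^{⌊d/2⌋}`. [folklore] -/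
theorem lrSlack_half_le (d t : ℕ) : lrSlack (d / 2) (d - d / 2) (2 * t) ≤ 12 * (t : ℝ) ^ 2 / 2 ^ (d / 2) := by
  unfold lrSlack
  have h1 : (1 : ℝ) / 2 ^ (d - d / 2) ≤ 1 / 2 ^ (d / 2) :=
    one_div_le_one_div_of_le (by positivity) (pow_le_pow_right₀ one_le_two (by omega))
  have h2 : (1 : ℝ) / 2 ^ (d / 2 + (d - d / 2)) ≤ 1 / 2 ^ (d / 2) :=
    one_div_le_one_div_of_le (by positivity) (pow_le_pow_right₀ one_le_two (by omega))
  have h3 : (1 : ℝ) / 2 ^ (d / 2) + 1 / 2 ^ (d - d / 2) + 1 / 2 ^ (d / 2 + (d - d / 2)) ≤ 3 * (1 / 2 ^ (d / 2)) := by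
    linarith
  have h4 : (((2 * t : ℕ) : ℝ)) ^ 2 = 4 * (t : ℝ) ^ 2 := by push_cast; ring
  rw [h4]
  calc 4 * (t : ℝ) ^ 2 * (1 / 2 ^ (d / 2) + 1 / 2 ^ (d - d / 2) + 1 / 2 ^ (d / 2 + (d - d / 2)))
      ≤ 4 * (t : ℝ) ^ 2 * (3 * (1 / 2 ^ (d / 2))) := mul_le_mul_of_nonneg_left h3 (by positivity)
    _ = 12 * (t : ℝ) ^ 2 / 2 ^ (d / 2) := by ring

/-- At `t ≤ 2^{d/6}` rounds the Luby–Rackoff slack is at most `17·2^{-d/6}` (`12·√2 < 17`). [folklore] -/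
theorem lrSlack_half_le_rpow (d t : ℕ) (ht : (t : ℝ) ≤ (2 : ℝ) ^ ((d : ℝ) / 6)) :
    lrSlack (d / 2) (d - d / 2) (2 * t) ≤ 17 * (2 : ℝ) ^ (-((d : ℝ) / 6)) := by
  refine (lrSlack_half_le d t).trans ?_
  have ht0 : (0 : ℝ) ≤ t := Nat.cast_nonneg _
  have ht2 : (t : ℝ) ^ 2 ≤ (2 : ℝ) ^ ((d : ℝ) / 3) := by
    calc (t : ℝ) ^ 2 ≤ ((2 : ℝ) ^ ((d : ℝ) / 6)) ^ 2 := pow_le_pow_left₀ ht0 ht 2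
      _ = (2 : ℝ) ^ ((d : ℝ) / 3) := by
          rw [← Real.rpow_natCast, ← Real.rpow_mul (by norm_num)]
          norm_num
          ring_nf
  have hfloor : (2 : ℝ) ^ (((d : ℝ) - 1) / 2) ≤ (2 : ℝ) ^ (d / 2) := by
    have hc : ((d : ℝ) - 1) / 2 ≤ ((d / 2 : ℕ) : ℝ) := by
      have : (d : ℝ) - 1 ≤ 2 * ((d / 2 : ℕ) : ℝ) := by
        have h' : d ≤ 2 * (d / 2) + 1 := by omega
        exact_mod_cast (by linarith [(by exact_mod_cast h' : (d : ℝ) ≤ 2 * ((d / 2 : ℕ) : ℝ) + 1)] :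
          (d : ℝ) - 1 ≤ 2 * ((d / 2 : ℕ) : ℝ))
      linarith
    calc (2 : ℝ) ^ (((d : ℝ) - 1) / 2) ≤ (2 : ℝ) ^ (((d / 2 : ℕ) : ℝ)) :=
          Real.rpow_le_rpow_of_exponent_le one_le_two hc
      _ = (2 : ℝ) ^ (d / 2) := Real.rpow_natCast 2 (d / 2)
  have hpos : (0 : ℝ) < (2 : ℝ) ^ (((d : ℝ) - 1) / 2) := by positivity
  have hsq : (12 : ℝ) * (2 : ℝ) ^ ((1 : ℝ) / 2) ≤ 17 := by
    have hs : (2 : ℝ) ^ ((1 : ℝ) / 2) = Real.sqrt 2 := by rw [Real.sqrt_eq_rpow]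
    rw [hs]
    have h17 : Real.sqrt 2 ≤ 17 / 12 := by
      rw [Real.sqrt_le_left (by norm_num)]
      norm_num
    linarith
  calc 12 * (t : ℝ) ^ 2 / 2 ^ (d / 2) ≤ 12 * (2 : ℝ) ^ ((d : ℝ) / 3) / (2 : ℝ) ^ (((d : ℝ) - 1) / 2) := by
        gcongr
    _ = 12 * (2 : ℝ) ^ ((1 : ℝ) / 2) * (2 : ℝ) ^ (-((d : ℝ) / 6)) := by
        rw [mul_assoc, ← Real.rpow_add (by norm_num : (0:ℝ) < 2), mul_div_assoc,
          ← Real.rpow_sub (by norm_num : (0:ℝ) < 2)]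
        congr 1
        ring_nf
    _ ≤ 17 * (2 : ℝ) ^ (-((d : ℝ) / 6)) := by
        gcongr

/-- **Numeric corollary of (i)** — the admissible parameter region of ideal model II: for `1 ≤ d`, `2d + 3 ≤ μ`,
`d + 8 ≤ μ` and `t ≤ 2^{d/6}` rounds, the ideal-II success probability of every bit-oracle walker is at most
`38 · 2^{-d/6} + 2^{2d+4} / 2^μ` — negligible exactly in stage 5's region (depth growing, tag length exceeding `2d + 4`
by a growing margin). -/
theorem idealCode_numeric (d μ : ℕ) (M : OracleAlg (List Bool)) (x : List Bool) (t : ℕ) (hd : 1 ≤ d)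
    (hμ : labelLen d ≤ μ) (hμ' : d + 8 ≤ μ) (ht : (t : ℝ) ≤ (2 : ℝ) ^ ((d : ℝ) / 6)) :
    codeSuccessProb d μ M x t ≤ 38 * (2 : ℝ) ^ (-((d : ℝ) / 6)) + (2 : ℝ) ^ (2 * d + 4) / 2 ^ μ := by
  have h := idealCodeSoundness_holds.1 d μ M x t hd hμ hμ' ht
  have h2 := Summit.QuantumAdvantage.QuantumAdvantage.Cruxes.WbwObfuscatedGluedTrees.KnowledgeOfWalkSplit.BlackBox.tagSlack_le
    d μ
  have h3 := lrSlack_half_le_rpow d t ht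
  have h4 : 2 * ((2 : ℝ) ^ (2 * d + 3) / 2 ^ μ) = (2 : ℝ) ^ (2 * d + 4) / 2 ^ μ := by rw [pow_succ]; ring
  linarith

/-- **The audit at the generator's own schedules** (`Λ : Params`: depth `Λ.depth n`, PRF parameter `Λ.prfParam n`):
the ideal-model-II black-box success probability against the code of `obfuscatedGluedTreesGen Λ` at seed length `n`,
in the admissible region. -/
theorem idealCode_params (Λ : Params) (n : ℕ) (M : OracleAlg (List Bool)) (x : List Bool) (t : ℕ)
    (hμ : labelLen (Λ.depth n) ≤ Λ.prfParam n) (hμ' : Λ.depth n + 8 ≤ Λ.prfParam n)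
    (ht : (t : ℝ) ≤ (2 : ℝ) ^ (((Λ.depth n : ℕ) : ℝ) / 6)) :
    codeSuccessProb (Λ.depth n) (Λ.prfParam n) M x t ≤
      38 * (2 : ℝ) ^ (-(((Λ.depth n : ℕ) : ℝ) / 6)) + (2 : ℝ) ^ (2 * Λ.depth n + 4) / 2 ^ Λ.prfParam n :=
  idealCode_numeric _ _ M x t (Λ.depth_pos n) hμ hμ' ht

/-! ## §4 Asymptotic form: clause-(C)-shaped negligibility of ideal model II against black-box walkers -/

section Asymptotic

open Filter Asymptotics

/-- A depth schedule eventually above `n^ε` makes `2^{-depth/6}` dominated by `2^{-n^{ε/2}}`. [folklore] -/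
theorem eventually_two_rpow_neg_depth_le {dep : ℕ → ℕ} {ε : ℝ} (hε : 0 < ε)
    (hdep : ∀ᶠ n : ℕ in atTop, (n : ℝ) ^ ε ≤ dep n) :
    ∀ᶠ n : ℕ in atTop, (2 : ℝ) ^ (-(((dep n : ℕ) : ℝ) / 6)) ≤ (2 : ℝ) ^ (-((n : ℝ) ^ (ε / 2))) := by
  -- eventually `6 · n^{ε/2} ≤ n^ε`, i.e. `6 ≤ n^{ε/2}`
  have h6 : ∀ᶠ n : ℕ in atTop, (6 : ℝ) ≤ (n : ℝ) ^ (ε / 2) := by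
    have ht : Tendsto (fun n : ℕ => (n : ℝ) ^ (ε / 2)) atTop atTop :=
      (tendsto_rpow_atTop (by linarith)).comp tendsto_natCast_atTop_atTop
    exact ht.eventually_ge_atTop 6
  filter_upwards [hdep, h6] with n hn h6n
  refine Real.rpow_le_rpow_of_exponent_le one_le_two ?_
  have hn0 : (0 : ℝ) ≤ (n : ℝ) ^ (ε / 2) := Real.rpow_nonneg (Nat.cast_nonneg _) _
  have hsq : (n : ℝ) ^ ε = (n : ℝ) ^ (ε / 2) * (n : ℝ) ^ (ε / 2) := by
    rw [← Real.rpow_add_of_nonneg (Nat.cast_nonneg _) (by linarith) (by linarith)]; ring_nf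
  have : 6 * (n : ℝ) ^ (ε / 2) ≤ (dep n : ℝ) := by
    calc 6 * (n : ℝ) ^ (ε / 2) ≤ (n : ℝ) ^ (ε / 2) * (n : ℝ) ^ (ε / 2) := mul_le_mul_of_nonneg_right h6n hn0
      _ = (n : ℝ) ^ ε := hsq.symm
      _ ≤ dep n := hn
  linarith

/-- **Negligibility of the stage-6 bound at admissible schedules**: if the depth is eventually above `n^ε` (`ε > 0`) and
the tag gap `2^{2d+4}/2^μ` is negligible, then `38·2^{-d/6} + 2^{2d+4}/2^μ` is negligible in `n`. [folklore] -/
theorem superpolynomialDecay_bound {dep prm : ℕ → ℕ} {ε : ℝ} (hε : 0 < ε)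
    (hdep : ∀ᶠ n : ℕ in atTop, (n : ℝ) ^ ε ≤ dep n)
    (hgap : SuperpolynomialDecay atTop (fun n : ℕ => (n : ℝ))
      (fun n => (2 : ℝ) ^ (2 * dep n + 4) / 2 ^ prm n)) :
    SuperpolynomialDecay atTop (fun n : ℕ => (n : ℝ))
      (fun n => 38 * (2 : ℝ) ^ (-(((dep n : ℕ) : ℝ) / 6)) + (2 : ℝ) ^ (2 * dep n + 4) / 2 ^ prm n) := by
  refine SuperpolynomialDecay.add ?_ hgap
  have h := (superpolynomialDecay_two_rpow_neg (half_pos hε)).const_mul 38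
  refine h.trans_eventually_abs_le ?_
  filter_upwards [eventually_two_rpow_neg_depth_le hε hdep] with n hn
  simp only [Function.comp_apply]
  rw [abs_of_nonneg (by positivity), abs_of_nonneg (by positivity)]
  linarith

/-- **Polynomial round budgets are admissible**: with the depth eventually above `n^ε`, every polynomial is eventually
at most `2^{d/6}`. [folklore] -/
theorem eventually_natPoly_le_two_rpow_depth {dep : ℕ → ℕ} {ε : ℝ} (hε : 0 < ε)
    (hdep : ∀ᶠ n : ℕ in atTop, (n : ℝ) ^ ε ≤ dep n) (p : Polynomial ℕ) :
    ∀ᶠ n : ℕ in atTop, ((p.eval n : ℕ) : ℝ) ≤ (2 : ℝ) ^ (((dep n : ℕ) : ℝ) / 6) := by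
  filter_upwards [eventually_natPoly_le_two_rpow p (half_pos hε), eventually_two_rpow_neg_depth_le hε hdep]
    with n hp hd
  refine hp.trans ?_
  -- `2^{n^{ε/2}} ≤ 2^{d/6}` from the negated-exponent comparison
  have h := Real.rpow_le_rpow_of_exponent_le one_le_two
    (show (n : ℝ) ^ (ε / 2) ≤ ((dep n : ℕ) : ℝ) / 6 from by
      have h' := (Real.rpow_le_rpow_left_iff one_lt_two).1 hd
      linarith)
  exact h

/-- **Ideal model II is black-box sound in the sense of clause (C)**: at schedules with depth eventually above `n^ε`,
no label truncation / domain separation eventually, and a negligible tag gap, for EVERY polynomial round budget `p` there is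
ONE negligible function bounding the ideal-II success probability of every bit-oracle walker (uniformly in the walker and
its advice) at all large seed lengths. -/
theorem idealCode_negligible (Λ : Params) {ε : ℝ} (hε : 0 < ε)
    (hdep : ∀ᶠ n : ℕ in atTop, (n : ℝ) ^ ε ≤ Λ.depth n)
    (hμ : ∀ᶠ n : ℕ in atTop, labelLen (Λ.depth n) ≤ Λ.prfParam n ∧ Λ.depth n + 8 ≤ Λ.prfParam n)
    (hgap : SuperpolynomialDecay atTop (fun n : ℕ => (n : ℝ))
      (fun n => (2 : ℝ) ^ (2 * Λ.depth n + 4) / 2 ^ Λ.prfParam n))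
    (p : Polynomial ℕ) :
    ∃ g : ℕ → ℝ, SuperpolynomialDecay atTop (fun n : ℕ => (n : ℝ)) g ∧
      ∀ᶠ n : ℕ in atTop, ∀ (M : OracleAlg (List Bool)) (x : List Bool),
        codeSuccessProb (Λ.depth n) (Λ.prfParam n) M x (p.eval n) ≤ g n :=
  ⟨_, superpolynomialDecay_bound hε hdep hgap, by
    filter_upwards [hμ, eventually_natPoly_le_two_rpow_depth hε hdep p] with n hn hp
    intro M x
    exact idealCode_numeric _ _ M x _ (Λ.depth_pos n) hn.1 hn.2 hp⟩

end Asymptotic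

/-- Registered helper stub of crux stmt-QuantumAdvantage-2340 (so that this numeric companion file lands `--supports`):
the Luby–Rackoff slack of the stage-6 bound is at most `12 t² / 2^{⌊d/2⌋}`. [folklore] -/
theorem toolkit_riNumeric : ∀ (d t : ℕ), lrSlack (d / 2) (d - d / 2) (2 * t) ≤ 12 * (t : ℝ) ^ 2 / 2 ^ (d / 2) :=
  lrSlack_half_le

end Summit.QuantumAdvantage.QuantumAdvantage.Cruxes.WbwObfuscatedGluedTrees.KnowledgeOfWalkSplit.RealIdeal

end
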